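/-
Copyright: statement-level skeleton of a published paper (lit-balaban cell, Phase-2 proof seat p18 gen 8). No proof claims
beyond what the kernel checks below.
-/
import Literature.MathematicalPhysics.QuantumFieldTheory.Balaban1983to89.B3Eq322PositiveDegree

/-!
# B3 — T. Bałaban, *(Higgs)₂,₃ quantum fields in a finite volume. III. Renormalization*, CMP **88** (1983) 411–445
[Balaban1983Higgs3], p. 439 [PDF 29] with p. 436 [PDF 26]: the generalized graph of **(3.22)** (*"The first graph on the right
side has positive degree"*) estimated IN THE PRINTED, CUBE-LOCALIZED FORM of (3.13) — *"We localize additionally the vertices in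
cubes Δ(v), Δ(v′), |Δ(v)| = |Δ(v′)| = (L^{j₁}η)^d … ≦ O(1) Σ_{Δ(v),Δ(v′)} sup_{x∈Δ(v)}|φ(x)| (L^{j₁}η)^{2d} …"* — for the kernel
hypotheses of `B3Eq322PositiveDegree.abs_rem322_le` and, with those hypotheses DISCHARGED, at the zero-field torus model instance
(`d = 3`).  File 3 (companion of `B3Eq322OneLegDifferentiated` / `B3Eq322PositiveDegree`, same seat).

statement-level skeleton of published theorems with citation tags; proofs where landed; nothing here is a claim about
the Yang–Mills mass gap

PDF held: `paper:balaban1983-higgs-2-3-quantum-fields-finite-volume` (journal page = PDF page + 410); pp. 436, 439 [PDF 26, 29] read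
in the OCR text and on the ×4 renders `…/1983-cmp88-higgs23-III-p026-x4.png`, `…-p029-x4.png`.

CITATION HEADER (lean-in-tree rule).  Part of the lit-balaban TYPED SKELETON (HOME `run/shared/lean/pub/lit-balaban/`), PHASE 2,
seat p18 generation 8 (free-target protocol G.5-34(d)).  WHAT IS REPRODUCED: row **B3.Eq3.21-3.24** of `HOME/lit-balaban-r15/ROWS-B3.md`
(fold owner r15, referee ref-4), sub-display (3.22), the sentence *"The first graph on the right side has positive degree"* in the
displayed form of the model estimate (3.13) p. 436.  CONSUMES BY NAME, nothing re-proved: own `B3Eq322OneLegDifferentiated`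
(`expr321b`, `rem322`) and `B3Eq322PositiveDegree` (`abs_rem322_le`, `eq322_zero_torus`), p20 g5's `B3Ineq314Cubes` (`cubes`,
`fiber`, `cdist`, `supOn`, the localization step `sum_sum_le_cubes` = the mechanism of *"We localize additionally the vertices in
cubes"*, `exp_tdist_le_exp_cdist`), p20 g5's `B3Sect3KernelsZeroTorus.gpiece`/`gpiece_bounds`, r15's `B3Sect3ScalarSelfEnergy`
(`d1Kernel`, `expr323`), p20 g2's `B3Taylor310Remainder.HolderDeriv`.

THE PRINTED TEXT (verbatim).  p. 439: *"The first graph on the right side [of (3.22)] has positive degree"*.  p. 436 (the model estimate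
whose form every later generalized graph is given, p. 437: *"The same statements apply to all expressions appearing in the future and
we will not repeat them"*): *"We localize additionally the vertices in cubes Δ(v), Δ(v′), |Δ(v)| = |Δ(v′)| = (L^{j₁}η)^d, j₁ = min{j, j′},
and we have (the expression (3.12)) ≦ O(1) Σ_{Δ(v),Δ(v′)} sup_{x∈Δ(v)} |φ(x)| (L^{j₁}η)^{2d} (L^jη)^{−d} exp[−δ₀(L^jη)^{−1}dist(Δ(v),Δ(v′))]
(L^{j′}η)^{−d+2} exp[−δ₀(L^{j′}η)^{−1}dist(Δ(v),Δ(v′))] · … (3.13)"*.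

WHAT IS PROVED, and how.  **`abs_rem322_le_cubes`** — the pointwise estimate `abs_rem322_le` of the generalized graph `rem322` of
(3.22) localized into cubes of ANY side `M ≥ 1` lattice steps (the print: `M = L^{j₁}`, `Mη = L^{j₁}η`):
`|rem322| ≤ d·C₁C₂Q²H(1 + 2/δ)·(min(s,s′))^α·Σ_{Δ,Δ′}(Mη)^{2d} sup_{x∈Δ}‖φ(x)‖·s^{1−d}e^{−½δ·η dist(Δ,Δ′)/s}·s′^{2−d}e^{−½δ·η dist(Δ,Δ′)/s′}`
— the displayed factors `Σ_{Δ(v),Δ(v′)} sup_{x∈Δ(v)}|φ(x)| (L^{j₁}η)^{2d} (L^jη)^{…}e^{…}(L^{j′}η)^{…}e^{…}(L^{j₁}η)^{α}·[Hölder constant]` for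
THIS graph (one differentiation on the scalar line: `(L^jη)^{1−d}`; the leg's Hölder weight: `(L^{j₁}η)^α`), `δ₀ = ½δ`, by p20's
`sum_sum_le_cubes`; **`eq322_zero_torus_cubes`** — the zero-field torus discharge `eq322_zero_torus` (`d = 3`) with clause (c) in
this cube-localized form for every piece `(j,j′)` and every cube side.
HONEST SCOPE: as in `B3Eq322PositiveDegree` (kernel bounds = hypotheses in `abs_rem322_le_cubes`; `d = 3`, `A = B̃ = 0`, the whole
torus, constants existential in `eq322_zero_torus_cubes`); the global Hölder constant `H` of the leg stands for the printed local
Hölder supremum (which it dominates).  D-0026: theorems only, no new definitions, no named facts, no `sorry`; standard axioms.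
Unit `lit-balaban-p18-g8` (literature-prover-lit-balaban-p18-g8-0), HOME `run/shared/lean/pub/lit-balaban/`, 2026-08-21.
-/

open scoped BigOperators RealInnerProductSpace

namespace Literature.MathematicalPhysics.QuantumFieldTheory.Balaban1983to89.B3Eq322Cubes

open Finset LatticeFieldCalculus B3Sect3ScalarSelfEnergy B3Taylor310Remainder B3Ineq314Cubes
open B3Sect3KernelsZeroTorus B3Eq323EtaZeroTorus B3Eq322OneLegDifferentiated B3Eq322PositiveDegree

noncomputable section

universe u

section Cubes

variable {P : Params} {j : ℕ} {W : Type*} [NormedAddCommGroup W] [InnerProductSpace ℝ W]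

/-- kernel: a constant dominating an absolute value through two positive factors is nonnegative. [folklore] -/
private theorem nonneg_of_abs_le_mul_mul' {v C p e : ℝ} (hp : 0 < p) (he : 0 < e) (h : |v| ≤ C * p * e) : 0 ≤ C :=
  nonneg_of_mul_nonneg_left (nonneg_of_mul_nonneg_left ((abs_nonneg v).trans h) he) hp

/-- **p. 439 "The first graph on the right side [of (3.22)] has positive degree" in the printed CUBE-LOCALIZED form of (3.13) p. 436**,
PROVED for every cube side `M ≥ 1` (the print: `M = L^{j₁}`, `Mη = L^{j₁}η`): under the hypotheses of
`B3Eq322PositiveDegree.abs_rem322_le` ((2.10)-type bounds on the differentiated scalar line at scale `s = L^jη` and the vector line at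
scale `s′ = L^{j′}η`, `|g|,|g′| ≤ 1`, `‖qw‖ ≤ Q‖w‖`, a Hölder-`α` derivative of the leg `φ′` with constant `H`),
`|rem322| ≤ d·C₁C₂Q²H(1+2/δ)·(min(s,s′))^α·Σ_{Δ,Δ′}(Mη)^{2d} sup_{x∈Δ}‖φ(x)‖·s^{1−d}e^{−½δ·η dist(Δ,Δ′)/s}·s′^{2−d}e^{−½δ·η dist(Δ,Δ′)/s′}`
— *"Σ_{Δ(v),Δ(v′)} sup_{x∈Δ(v)}|φ(x)| (L^{j₁}η)^{2d} (L^jη)^{…} exp[…] (L^{j′}η)^{…} exp[…]"* with `δ₀ = ½δ`, the gain `(L^{j₁}η)^α` of the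
positive degree. [cite: Balaban1983Higgs3, (3.13) p.436, (3.22) p.439] -/
theorem abs_rem322_le_cubes (η : ℝ) (hη : 0 < η) {α H Q C₁ C₂ δ s s' : ℝ} (hα0 : 0 ≤ α) (hα1 : α ≤ 1) (hH : 0 ≤ H)
    (hQ : 0 ≤ Q) (hδ : 0 < δ) (hs : 0 < s) (hs' : 0 < s') (q : W →ₗ[ℝ] W) (hq : ∀ w : W, ‖q w‖ ≤ Q * ‖w‖)
    (G0 Gj : Kernel P j) (g g' : SiteField P j ℝ) (hg : ∀ x, |g x| ≤ 1) (hg' : ∀ x, |g' x| ≤ 1)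
    (hG0 : ∀ (μ : Fin P.d) (x x' : Site P j),
      |d1Kernel η⁻¹ μ G0 x x'| ≤ C₁ * s ^ ((1 : ℝ) - (P.d : ℝ)) * Real.exp (-(δ * s⁻¹ * (η * Site.tdist x x'))))
    (hGj : ∀ x x' : Site P j,
      |Gj x x'| ≤ C₂ * s' ^ ((2 : ℝ) - (P.d : ℝ)) * Real.exp (-(δ * s'⁻¹ * (η * Site.tdist x x'))))
    (φ φ' : SiteField P j W) (hφ' : HolderDeriv η⁻¹ α H φ') {M : ℕ} (hM : 0 < M) :
    |rem322 η q G0 Gj g g' φ φ'| ≤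
      P.d * C₁ * C₂ * Q ^ 2 * H * (1 + 2 / δ) * (min s s') ^ α *
        ∑ c ∈ cubes P j M, ∑ c' ∈ cubes P j M, ((M : ℝ) * η) ^ (2 * P.d) *
          (supOn (fiber M c : Finset (Site P j)) (fun x => ‖φ x‖) *
            ((s ^ ((1 : ℝ) - (P.d : ℝ)) * Real.exp (-(δ / 2 * s⁻¹ * (η * (cdist P j M M c c' : ℝ))))) *
              (s' ^ ((2 : ℝ) - (P.d : ℝ)) * Real.exp (-(δ / 2 * s'⁻¹ * (η * (cdist P j M M c c' : ℝ))))))) := by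
  have hpt := abs_rem322_le η hη hα0 hα1 hH hQ hδ hs hs' q hq G0 Gj g g' hg hg' hG0 hGj φ φ' hφ'
  have hC₁ : 0 ≤ C₁ :=
    nonneg_of_abs_le_mul_mul' (Real.rpow_pos_of_pos hs _) (Real.exp_pos _) (hG0 ⟨0, P.hd⟩ default default)
  have hC₂ : 0 ≤ C₂ := nonneg_of_abs_le_mul_mul' (Real.rpow_pos_of_pos hs' _) (Real.exp_pos _) (hGj default default)
  have hm : 0 ≤ (min s s') ^ α := Real.rpow_nonneg (lt_min hs hs').le _
  have hK : 0 ≤ P.d * C₁ * C₂ * Q ^ 2 * H * (1 + 2 / δ) * (min s s') ^ α := by positivity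
  -- the localization step on the weight of the estimate
  have hloc := sum_sum_le_cubes hM hη.le (fun x => ‖φ x‖) (fun x => norm_nonneg _)
    (fun x x' => (s ^ ((1 : ℝ) - (P.d : ℝ)) * Real.exp (-(δ / 2 * s⁻¹ * (η * Site.tdist x x')))) *
      (s' ^ ((2 : ℝ) - (P.d : ℝ)) * Real.exp (-(δ / 2 * s'⁻¹ * (η * Site.tdist x x')))))
    (fun x x' => by positivity)
    (fun c c' => (s ^ ((1 : ℝ) - (P.d : ℝ)) * Real.exp (-(δ / 2 * s⁻¹ * (η * (cdist P j M M c c' : ℝ))))) *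
      (s' ^ ((2 : ℝ) - (P.d : ℝ)) * Real.exp (-(δ / 2 * s'⁻¹ * (η * (cdist P j M M c c' : ℝ))))))
    (fun x x' => mul_le_mul
      (mul_le_mul_of_nonneg_left (exp_tdist_le_exp_cdist (by positivity) hη.le M M x x') (Real.rpow_pos_of_pos hs _).le)
      (mul_le_mul_of_nonneg_left (exp_tdist_le_exp_cdist (by positivity) hη.le M M x x') (Real.rpow_pos_of_pos hs' _).le)
      (by positivity) (by positivity))
  have hre : (∑ x : Site P j, ∑ x' : Site P j, η ^ (2 * P.d) *
      (‖φ x‖ * (s ^ ((1 : ℝ) - (P.d : ℝ)) * Real.exp (-(δ / 2 * s⁻¹ * (η * Site.tdist x x'))))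
        * (s' ^ ((2 : ℝ) - (P.d : ℝ)) * Real.exp (-(δ / 2 * s'⁻¹ * (η * Site.tdist x x')))))) =
      ∑ x : Site P j, ∑ x' : Site P j, η ^ (2 * P.d) *
        (‖φ x‖ * ((s ^ ((1 : ℝ) - (P.d : ℝ)) * Real.exp (-(δ / 2 * s⁻¹ * (η * Site.tdist x x')))) *
          (s' ^ ((2 : ℝ) - (P.d : ℝ)) * Real.exp (-(δ / 2 * s'⁻¹ * (η * Site.tdist x x')))))) :=
    Finset.sum_congr rfl fun x _ => Finset.sum_congr rfl fun x' _ => by ring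
  rw [hre] at hpt
  exact hpt.trans (mul_le_mul_of_nonneg_left hloc hK)

end Cubes

section ZeroTorus

/-- **(3.22)–(3.23) AT THE ZERO-FIELD TORUS MODEL INSTANCE (`d = 3`) with the estimate of the generalized graph in its DISPLAYED
cube-localized form**: the chain identity (a) and the vertex bound (b) of `B3Eq322PositiveDegree.eq322_zero_torus` together with (c′):
for every piece `(j,j′)` of the tower and every cube side `M ≥ 1`,
`|rem322[j,j′]| ≤ d·C²Q²H(1+2/δ)(L^{j₁}η)^α·Σ_{Δ,Δ′}(Mη)^{2d}sup_{x∈Δ}‖φ(x)‖(L^jη)^{1−d}e^{−½δ·dist(Δ,Δ′)/L^jη}(L^{j′}η)^{2−d}e^{−½δ·dist(Δ,Δ′)/L^{j′}η}`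
(kernel hypotheses discharged by `gpiece_bounds`). [cite: Balaban1983Higgs3, (3.13) p.436, (3.22)–(3.23) p.439] -/
theorem eq322_zero_torus_cubes (L : ℕ) (hL : Odd L ∧ 1 < L) {a : ℝ} (ha : 0 < a) {msq : ℝ} (hmsq : 0 ≤ msq) :
    ∃ δ C C₁ C₂ : ℝ, 0 < δ ∧ 0 < C ∧ 0 < C₁ ∧ 0 < C₂ ∧ ∀ (P : Params), P.d = 3 → P.L = L → ∀ k : ℕ, 1 ≤ k → k ≤ P.K →
      ∀ {W : Type u} [NormedAddCommGroup W] [InnerProductSpace ℝ W] {α H Q K' : ℝ}, 0 ≤ α → α ≤ 1 → 0 ≤ H → 0 ≤ Q →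
        0 ≤ K' → ∀ (q : W →ₗ[ℝ] W), (∀ w : W, ‖q w‖ ≤ Q * ‖w‖) →
        ∀ (g g' : SiteField P 0 ℝ), (∀ x, |g x| ≤ 1) → (∀ x, |g' x| ≤ 1) →
        (∀ x x' : Site P 0, |g' x' - g' x| ≤ K' * (P.eps * Site.tdist x x')) →
        ∀ (φ φ' : SiteField P 0 W), HolderDeriv (P.eps)⁻¹ α H φ' →
          (∑ i ∈ range k, ∑ i' ∈ range k, expr321b P.eps q (gpiece P a msq k i) (gpiece P a msq k i') g g' φ φ' =
              (∑ i ∈ range k, ∑ i' ∈ range k, rem322 P.eps q (gpiece P a msq k i) (gpiece P a msq k i') g g' φ φ') +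
                expr323 P.eps q (∑ i ∈ range k, gpiece P a msq k i) (∑ i ∈ range k, gpiece P a msq k i) g g' φ φ') ∧
          |expr323 P.eps q (∑ i ∈ range k, gpiece P a msq k i) (∑ i ∈ range k, gpiece P a msq k i) g g' φ φ'| ≤
            (C₁ + C₂ * K') * ∑ μ : Fin P.d, ∑ x : Site P 0, P.eps ^ P.d * (‖φ x‖ * ‖q (q (pdiff P.eps⁻¹ μ φ' x))‖) ∧
          ∀ (i i' : ℕ) {M : ℕ}, 0 < M →
            |rem322 P.eps q (gpiece P a msq k i) (gpiece P a msq k i') g g' φ φ'| ≤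
              P.d * C * C * Q ^ 2 * H * (1 + 2 / δ) * (min (P.spacing i) (P.spacing i')) ^ α *
                ∑ c ∈ cubes P 0 M, ∑ c' ∈ cubes P 0 M, ((M : ℝ) * P.eps) ^ (2 * P.d) *
                  (supOn (fiber M c : Finset (Site P 0)) (fun x => ‖φ x‖) *
                    ((P.spacing i ^ ((1 : ℝ) - (P.d : ℝ)) *
                        Real.exp (-(δ / 2 * (P.spacing i)⁻¹ * (P.eps * (cdist P 0 M M c c' : ℝ))))) *
                      (P.spacing i' ^ ((2 : ℝ) - (P.d : ℝ)) *
                        Real.exp (-(δ / 2 * (P.spacing i')⁻¹ * (P.eps * (cdist P 0 M M c c' : ℝ))))))) := by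
  obtain ⟨δ, C, hδ, hC, Hk⟩ := gpiece_bounds 3 L (by norm_num) hL ha hmsq
  obtain ⟨C₁, C₂, hC₁, hC₂, H23⟩ := abs_expr323_eta_le_uniform.{u} L hL ha hmsq
  refine ⟨δ, C, C₁, C₂, hδ, hC, hC₁, hC₂, ?_⟩
  intro P hPd hPL k hk1 hkK W _ _ α H Q K' hα0 hα1 hH hQ hK' q hq g g' hg hg' hlip φ φ' hφ'
  obtain ⟨hv, hrow, -, -⟩ := Hk P hPd hPL k hk1 hkK
  refine ⟨sum_expr321b_eq P.eps q k _ _ g g' φ φ', H23 P hPd hPL k hk1 hkK q K' hK' g g' φ φ' hg hg' hlip,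
    fun i i' M hM => ?_⟩
  exact abs_rem322_le_cubes P.eps P.eps_pos hα0 hα1 hH hQ hδ (P.spacing_pos i) (P.spacing_pos i') q hq _ _ g g' hg hg'
    (fun μ x x' => hrow i μ x x') (hv i') φ φ' hφ' hM

end ZeroTorus

end

end Literature.MathematicalPhysics.QuantumFieldTheory.Balaban1983to89.B3Eq322Cubes
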